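import Mathlib
import Summits.ValiantsHypothesis.ValiantsHypothesis.Theorems.KPlusLogSqLawStepSupStructure

/-!
# The PARTNER LAW (static path model behind `KPlusLogSqLaw.TropicalB`)

Cell pub-symmetroid, seat conjb-2 (g22). A helper toward the crux `TropicalB`
(`Summit.ValiantsHypothesis.ValiantsHypothesis.Theses.KPlusLogSqLaw.TropicalB`, item
`stmt-ValiantsHypothesis-19771`); it earns no crux credit and is not evidence for `MatrixDescartes` or for
Valiant's hypothesis.

Setting (as in `KPlusLogSqLawStepSupStructure`): lines `S_t(θ) = b t + s t * θ`, a class `up` of upper lines (the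
even lines in the parity statements), the window `[u, v]` separated at `θ` iff every upper line of `[u, v]` is
strictly above every other line of `[u, v]` at `θ`, `T[u, v]` its separation set; row `j` of odd reach `d` STEPS iff
`T[j, j+d]` and `T[j+1, j+d+1]` are non-empty and disjoint, and the step moves RIGHT iff the second lies to the right
of the first.

THEOREM (PARTNER LAW, THEORY-NOTE-g22 §3; found as the exact residue of the six earlier sign laws at reach 5 with
three steps — the 36 order types at `d = 5` that pass the step criterion, the continuation laws, the zigzag, triple
and four-step laws but are not realisable are exactly its violators — then proved for every odd reach). Let rows
`i` and `i+2` step to the right and let `T[i+1, i+d+1]` lie to the left of `T[i+2, i+d+2]` (three consecutive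
right-moving steps). By `step_sup_structure`, at `r₀ = sup T[i, i+d]` the leaving line `i` is bound to an inner
partner `p` of the other class with `s i < s p < s (i+d+1)`, and at `r₂ = sup T[i+2, i+d+2]` the line `i+2` is
bound to a partner `q` with `s (i+2) < s q < s (i+d+3)`. LAW: it is impossible that every such admissible pair has
`p ≥ i+2`, `q ≤ i+d` and `s q < s p`. PROOF: for the realised pair, `p` and `q` lie in both windows, so the window
comparisons give `S_q(r₀) ≤ S_i(r₀) = S_p(r₀)` and `S_p(r₂) ≤ S_{i+2}(r₂) = S_q(r₂)`; but `r₀ < r₂` (a point of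
`T[i+1, i+d+1]` and one of `T[i+2, i+d+2]` lie between) and `S_p - S_q` is strictly increasing. `partner_law_core`
is the class-generic statement; `partner_law_even` / `partner_law_odd` (first line even / odd, steps moving right)
follow by the transport `S ↦ -S` (`sep_neg`); the left-moving mirror statements are in
`KPlusLogSqLawStepPartnerMirror` (transports `θ ↦ -θ`, `sep_refl`, and the composite `sep_negrefl`, kept here).
-/

set_option linter.dupNamespace false

namespace Summit.ValiantsHypothesis.ValiantsHypothesis.Theorems.KPlusLogSqLawStepPartner

open Summit.ValiantsHypothesis.ValiantsHypothesis.Theorems.KPlusLogSqLawStepSupStructure (step_sup_structure)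

/-- PARTNER LAW, class-generic core (rows `i`, `i+2` step to the right, `T[i+1,i+d+1]` left of `T[i+2,i+d+2]`,
outer lines `i`, `i+d+1`, `i+2`, `i+d+3` upper). -/
theorem partner_law_core (up : ℕ → Prop) (s b : ℕ → ℝ) (i d : ℕ) (hup0 : up i) (hup1 : up (i + d + 1))
    (hup2 : up (i + 2)) (hup3 : up (i + d + 3))
    (hlow0 : ∃ o : ℕ, i + 1 ≤ o ∧ o ≤ i + d ∧ ¬ up o) (hlow2 : ∃ o : ℕ, i + 3 ≤ o ∧ o ≤ i + d + 2 ∧ ¬ up o)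
    (hA0 : ∃ θ : ℝ, ∀ e o : ℕ, i ≤ e → e ≤ i + d → i ≤ o → o ≤ i + d → up e → ¬ up o →
      b o + s o * θ < b e + s e * θ)
    (hB0 : ∃ θ : ℝ, ∀ e o : ℕ, i + 1 ≤ e → e ≤ i + d + 1 → i + 1 ≤ o → o ≤ i + d + 1 → up e → ¬ up o →
      b o + s o * θ < b e + s e * θ)
    (hord0 : ∀ θ θ' : ℝ, (∀ e o : ℕ, i ≤ e → e ≤ i + d → i ≤ o → o ≤ i + d → up e → ¬ up o →
      b o + s o * θ < b e + s e * θ) → (∀ e o : ℕ, i + 1 ≤ e → e ≤ i + d + 1 → i + 1 ≤ o → o ≤ i + d + 1 →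
      up e → ¬ up o → b o + s o * θ' < b e + s e * θ') → θ < θ')
    (hord1 : ∀ θ θ' : ℝ, (∀ e o : ℕ, i + 1 ≤ e → e ≤ i + d + 1 → i + 1 ≤ o → o ≤ i + d + 1 → up e → ¬ up o →
      b o + s o * θ < b e + s e * θ) → (∀ e o : ℕ, i + 2 ≤ e → e ≤ i + d + 2 → i + 2 ≤ o → o ≤ i + d + 2 →
      up e → ¬ up o → b o + s o * θ' < b e + s e * θ') → θ < θ')
    (hA2 : ∃ θ : ℝ, ∀ e o : ℕ, i + 2 ≤ e → e ≤ i + d + 2 → i + 2 ≤ o → o ≤ i + d + 2 → up e → ¬ up o →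
      b o + s o * θ < b e + s e * θ)
    (hB2 : ∃ θ : ℝ, ∀ e o : ℕ, i + 3 ≤ e → e ≤ i + d + 3 → i + 3 ≤ o → o ≤ i + d + 3 → up e → ¬ up o →
      b o + s o * θ < b e + s e * θ)
    (hord2 : ∀ θ θ' : ℝ, (∀ e o : ℕ, i + 2 ≤ e → e ≤ i + d + 2 → i + 2 ≤ o → o ≤ i + d + 2 → up e → ¬ up o →
      b o + s o * θ < b e + s e * θ) → (∀ e o : ℕ, i + 3 ≤ e → e ≤ i + d + 3 → i + 3 ≤ o → o ≤ i + d + 3 →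
      up e → ¬ up o → b o + s o * θ' < b e + s e * θ') → θ < θ')
    (hQ : ∀ p q : ℕ, i + 1 ≤ p → p ≤ i + d → ¬ up p → s i < s p → s p < s (i + d + 1) →
      i + 3 ≤ q → q ≤ i + d + 2 → ¬ up q → s (i + 2) < s q → s q < s (i + d + 3) →
      i + 2 ≤ p ∧ q ≤ i + d ∧ s q < s p) :
    False := by
  obtain ⟨r0, p, hp1, hp2, hpl, hsp1, hsp2, heq0, hcmp0, -, -, hBgt0⟩ :=
    step_sup_structure up s b i d hup0 hup1 hlow0 hA0 hB0 (fun θ h => lt_irrefl θ (hord0 θ θ h.1 h.2)) hord0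
  obtain ⟨θ2, hθ2⟩ := hA2
  obtain ⟨θ3, hθ3⟩ := hB2
  obtain ⟨o2, ho2a, ho2b, ho2c⟩ := hlow2
  have hup3' : up (i + 2 + d + 1) := by
    have e : i + 2 + d + 1 = i + d + 3 := by omega
    rw [e]
    exact hup3
  -- the sup structure of row `i + 2` (windows rewritten from `i + 2 + d` to `i + d + 2`)
  obtain ⟨r2, q, hq1, hq2, hql, hsq1, hsq2, heq2, hcmp2, hTle2, -, -⟩ :=
    step_sup_structure up s b (i + 2) d hup2 hup3' ⟨o2, by omega, by omega, ho2c⟩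
      ⟨θ2, fun e o h1 h2 h3 h4 he ho => hθ2 e o h1 (by omega) h3 (by omega) he ho⟩
      ⟨θ3, fun e o h1 h2 h3 h4 he ho => hθ3 e o (by omega) (by omega) (by omega) (by omega) he ho⟩
      (fun θ h => lt_irrefl θ (hord2 θ θ
        (fun e o h1 h2 h3 h4 he ho => h.1 e o h1 (by omega) h3 (by omega) he ho)
        (fun e o h1 h2 h3 h4 he ho => h.2 e o (by omega) (by omega) (by omega) (by omega) he ho)))
      (fun θ θ' hθ hθ' => hord2 θ θ'
        (fun e o h1 h2 h3 h4 he ho => hθ e o h1 (by omega) h3 (by omega) he ho)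
        (fun e o h1 h2 h3 h4 he ho => hθ' e o (by omega) (by omega) (by omega) (by omega) he ho))
  have hsq2' : s q < s (i + d + 3) := by
    have e : i + d + 3 = i + 2 + d + 1 := by omega
    rw [e]
    exact hsq2
  -- the slope clause for the realised partners
  obtain ⟨hp3, hq3, hqp⟩ := hQ p q hp1 hp2 hpl hsp1 hsp2 (by omega) (by omega) hql hsq1 hsq2'
  -- `r0 < r2`: a point of `T[i+1, i+d+1]` and one of `T[i+2, i+d+2]` lie between
  obtain ⟨θ1, hθ1⟩ := hB0
  have h01 : r0 < θ1 := hBgt0 θ1 hθ1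
  have h12 : θ1 < θ2 := hord1 θ1 θ2 hθ1 hθ2
  have h2r : θ2 ≤ r2 := hTle2 θ2 (fun e o h1 h2 h3 h4 he ho => hθ2 e o h1 (by omega) h3 (by omega) he ho)
  -- window comparisons at the two suprema
  have hq0 : b q + s q * r0 ≤ b i + s i * r0 := hcmp0 i q le_rfl (by omega) (by omega) hq3 hup0 hql
  have hp2' : b p + s p * r2 ≤ b (i + 2) + s (i + 2) * r2 :=
    hcmp2 (i + 2) p le_rfl (by omega) hp3 (by omega) hup2 hpl
  have key : (s p - s q) * (r2 - r0) = s p * r2 - s p * r0 - s q * r2 + s q * r0 := by ring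
  have pos : 0 < (s p - s q) * (r2 - r0) := mul_pos (by linarith) (by linarith)
  linarith

/-- Transport `S ↦ -S` (classes swapped, separation sets kept): even-above-odd separation of `S` is odd-above-even
separation of `-S`. -/
theorem sep_neg (s b : ℕ → ℝ) (lo hi : ℕ) (θ : ℝ)
    (h : ∀ e o : ℕ, lo ≤ e → e ≤ hi → lo ≤ o → o ≤ hi → Even e → Odd o → b o + s o * θ < b e + s e * θ) :
    ∀ e o : ℕ, lo ≤ e → e ≤ hi → lo ≤ o → o ≤ hi → Odd e → ¬ Odd o → -b o + -s o * θ < -b e + -s e * θ := by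
  intro e o h1 h2 h3 h4 he ho
  have := h o e h3 h4 h1 h2 (Nat.not_odd_iff_even.mp ho) he
  have r1 : -s o * θ = -(s o * θ) := by ring
  have r2 : -s e * θ = -(s e * θ) := by ring
  linarith

/-- Inverse of `sep_neg`. -/
theorem sep_of_neg (s b : ℕ → ℝ) (lo hi : ℕ) (θ : ℝ)
    (h : ∀ e o : ℕ, lo ≤ e → e ≤ hi → lo ≤ o → o ≤ hi → Odd e → ¬ Odd o → -b o + -s o * θ < -b e + -s e * θ) :
    ∀ e o : ℕ, lo ≤ e → e ≤ hi → lo ≤ o → o ≤ hi → Even e → Odd o → b o + s o * θ < b e + s e * θ := by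
  intro e o h1 h2 h3 h4 he ho
  have := h o e h3 h4 h1 h2 ho (Nat.not_odd_iff_even.mpr he)
  have r1 : -s o * θ = -(s o * θ) := by ring
  have r2 : -s e * θ = -(s e * θ) := by ring
  linarith

/-- Transport `θ ↦ -θ` (slopes negated, classes kept): separation of `S` at `θ` is separation of the reflected
lines at `-θ`. -/
theorem sep_refl (s b : ℕ → ℝ) (lo hi : ℕ) (θ : ℝ)
    (h : ∀ e o : ℕ, lo ≤ e → e ≤ hi → lo ≤ o → o ≤ hi → Even e → Odd o → b o + s o * θ < b e + s e * θ) :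
    ∀ e o : ℕ, lo ≤ e → e ≤ hi → lo ≤ o → o ≤ hi → Even e → ¬ Even o →
      b o + -s o * -θ < b e + -s e * -θ := by
  intro e o h1 h2 h3 h4 he ho
  have := h e o h1 h2 h3 h4 he (Nat.not_even_iff_odd.mp ho)
  have r1 : -s o * -θ = s o * θ := by ring
  have r2 : -s e * -θ = s e * θ := by ring
  linarith

/-- Inverse direction of `sep_refl`: separation of the reflected lines at `θ` is separation of `S` at `-θ`. -/
theorem sep_of_refl (s b : ℕ → ℝ) (lo hi : ℕ) (θ : ℝ)
    (h : ∀ e o : ℕ, lo ≤ e → e ≤ hi → lo ≤ o → o ≤ hi → Even e → ¬ Even o →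
      b o + -s o * θ < b e + -s e * θ) :
    ∀ e o : ℕ, lo ≤ e → e ≤ hi → lo ≤ o → o ≤ hi → Even e → Odd o → b o + s o * -θ < b e + s e * -θ := by
  intro e o h1 h2 h3 h4 he ho
  have := h e o h1 h2 h3 h4 he (Nat.not_even_iff_odd.mpr ho)
  have r1 : s o * -θ = -s o * θ := by ring
  have r2 : s e * -θ = -s e * θ := by ring
  linarith

/-- Transport `S_t(θ) ↦ -S_t(-θ)` (slopes kept, intercepts negated, classes swapped). -/
theorem sep_negrefl (s b : ℕ → ℝ) (lo hi : ℕ) (θ : ℝ)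
    (h : ∀ e o : ℕ, lo ≤ e → e ≤ hi → lo ≤ o → o ≤ hi → Even e → Odd o → b o + s o * θ < b e + s e * θ) :
    ∀ e o : ℕ, lo ≤ e → e ≤ hi → lo ≤ o → o ≤ hi → Odd e → ¬ Odd o →
      -b o + s o * -θ < -b e + s e * -θ := by
  intro e o h1 h2 h3 h4 he ho
  have := h o e h3 h4 h1 h2 (Nat.not_odd_iff_even.mp ho) he
  have r1 : s o * -θ = -(s o * θ) := by ring
  have r2 : s e * -θ = -(s e * θ) := by ring
  linarith

/-- Inverse direction of `sep_negrefl`. -/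
theorem sep_of_negrefl (s b : ℕ → ℝ) (lo hi : ℕ) (θ : ℝ)
    (h : ∀ e o : ℕ, lo ≤ e → e ≤ hi → lo ≤ o → o ≤ hi → Odd e → ¬ Odd o →
      -b o + s o * θ < -b e + s e * θ) :
    ∀ e o : ℕ, lo ≤ e → e ≤ hi → lo ≤ o → o ≤ hi → Even e → Odd o → b o + s o * -θ < b e + s e * -θ := by
  intro e o h1 h2 h3 h4 he ho
  have := h o e h3 h4 h1 h2 ho (Nat.not_odd_iff_even.mpr he)
  have r1 : s o * -θ = -(s o * θ) := by ring
  have r2 : s e * -θ = -(s e * θ) := by ring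
  linarith

/-- PARTNER LAW, first line `i` even, three right-moving steps: it is impossible that every admissible partner `p`
of row `i` (odd, `s i < s p < s (i+d+1)`) and `q` of row `i+2` (odd, `s (i+2) < s q < s (i+d+3)`) satisfy
`i+2 ≤ p`, `q ≤ i+d`, `s q < s p`. -/
theorem partner_law_even (s b : ℕ → ℝ) (i d : ℕ) (hi : Even i) (hd : Odd d)
    (hA0 : ∃ θ : ℝ, ∀ e o : ℕ, i ≤ e → e ≤ i + d → i ≤ o → o ≤ i + d → Even e → Odd o →
      b o + s o * θ < b e + s e * θ)
    (hB0 : ∃ θ : ℝ, ∀ e o : ℕ, i + 1 ≤ e → e ≤ i + d + 1 → i + 1 ≤ o → o ≤ i + d + 1 → Even e → Odd o →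
      b o + s o * θ < b e + s e * θ)
    (hord0 : ∀ θ θ' : ℝ, (∀ e o : ℕ, i ≤ e → e ≤ i + d → i ≤ o → o ≤ i + d → Even e → Odd o →
      b o + s o * θ < b e + s e * θ) → (∀ e o : ℕ, i + 1 ≤ e → e ≤ i + d + 1 → i + 1 ≤ o → o ≤ i + d + 1 →
      Even e → Odd o → b o + s o * θ' < b e + s e * θ') → θ < θ')
    (hord1 : ∀ θ θ' : ℝ, (∀ e o : ℕ, i + 1 ≤ e → e ≤ i + d + 1 → i + 1 ≤ o → o ≤ i + d + 1 → Even e →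
      Odd o → b o + s o * θ < b e + s e * θ) → (∀ e o : ℕ, i + 2 ≤ e → e ≤ i + d + 2 → i + 2 ≤ o →
      o ≤ i + d + 2 → Even e → Odd o → b o + s o * θ' < b e + s e * θ') → θ < θ')
    (hA2 : ∃ θ : ℝ, ∀ e o : ℕ, i + 2 ≤ e → e ≤ i + d + 2 → i + 2 ≤ o → o ≤ i + d + 2 → Even e → Odd o →
      b o + s o * θ < b e + s e * θ)
    (hB2 : ∃ θ : ℝ, ∀ e o : ℕ, i + 3 ≤ e → e ≤ i + d + 3 → i + 3 ≤ o → o ≤ i + d + 3 → Even e → Odd o →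
      b o + s o * θ < b e + s e * θ)
    (hord2 : ∀ θ θ' : ℝ, (∀ e o : ℕ, i + 2 ≤ e → e ≤ i + d + 2 → i + 2 ≤ o → o ≤ i + d + 2 → Even e →
      Odd o → b o + s o * θ < b e + s e * θ) → (∀ e o : ℕ, i + 3 ≤ e → e ≤ i + d + 3 → i + 3 ≤ o →
      o ≤ i + d + 3 → Even e → Odd o → b o + s o * θ' < b e + s e * θ') → θ < θ')
    (hQ : ∀ p q : ℕ, i + 1 ≤ p → p ≤ i + d → Odd p → s i < s p → s p < s (i + d + 1) →
      i + 3 ≤ q → q ≤ i + d + 2 → Odd q → s (i + 2) < s q → s q < s (i + d + 3) →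
      i + 2 ≤ p ∧ q ≤ i + d ∧ s q < s p) :
    False := by
  have hd1 : 1 ≤ d := by
    obtain ⟨l, hl⟩ := hd
    omega
  have hi1 : ¬ Even (i + 1) := by
    obtain ⟨k, hk⟩ := hi
    exact Nat.not_even_iff_odd.mpr ⟨k, by omega⟩
  have hi3 : ¬ Even (i + 3) := by
    obtain ⟨k, hk⟩ := hi
    exact Nat.not_even_iff_odd.mpr ⟨k + 1, by omega⟩
  have hup1 : Even (i + d + 1) := by
    obtain ⟨k, hk⟩ := hi
    obtain ⟨l, hl⟩ := hd
    exact ⟨k + l + 1, by omega⟩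
  have hup2 : Even (i + 2) := by
    obtain ⟨k, hk⟩ := hi
    exact ⟨k + 1, by omega⟩
  have hup3 : Even (i + d + 3) := by
    obtain ⟨k, hk⟩ := hi
    obtain ⟨l, hl⟩ := hd
    exact ⟨k + l + 2, by omega⟩
  obtain ⟨θA, hθA⟩ := hA0
  obtain ⟨θB, hθB⟩ := hB0
  obtain ⟨θC, hθC⟩ := hA2
  obtain ⟨θD, hθD⟩ := hB2
  exact partner_law_core (fun n => Even n) s b i d hi hup1 hup2 hup3 ⟨i + 1, le_rfl, by omega, hi1⟩
    ⟨i + 3, le_rfl, by omega, hi3⟩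
    ⟨θA, fun e o h1 h2 h3 h4 he ho => hθA e o h1 h2 h3 h4 he (Nat.not_even_iff_odd.mp ho)⟩
    ⟨θB, fun e o h1 h2 h3 h4 he ho => hθB e o h1 h2 h3 h4 he (Nat.not_even_iff_odd.mp ho)⟩
    (fun θ θ' hθ hθ' => hord0 θ θ'
      (fun e o h1 h2 h3 h4 he ho => hθ e o h1 h2 h3 h4 he (Nat.not_even_iff_odd.mpr ho))
      (fun e o h1 h2 h3 h4 he ho => hθ' e o h1 h2 h3 h4 he (Nat.not_even_iff_odd.mpr ho)))
    (fun θ θ' hθ hθ' => hord1 θ θ'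
      (fun e o h1 h2 h3 h4 he ho => hθ e o h1 h2 h3 h4 he (Nat.not_even_iff_odd.mpr ho))
      (fun e o h1 h2 h3 h4 he ho => hθ' e o h1 h2 h3 h4 he (Nat.not_even_iff_odd.mpr ho)))
    ⟨θC, fun e o h1 h2 h3 h4 he ho => hθC e o h1 h2 h3 h4 he (Nat.not_even_iff_odd.mp ho)⟩
    ⟨θD, fun e o h1 h2 h3 h4 he ho => hθD e o h1 h2 h3 h4 he (Nat.not_even_iff_odd.mp ho)⟩
    (fun θ θ' hθ hθ' => hord2 θ θ'
      (fun e o h1 h2 h3 h4 he ho => hθ e o h1 h2 h3 h4 he (Nat.not_even_iff_odd.mpr ho))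
      (fun e o h1 h2 h3 h4 he ho => hθ' e o h1 h2 h3 h4 he (Nat.not_even_iff_odd.mpr ho)))
    (fun p q g1 g2 gp g3 g4 g5 g6 gq g7 g8 => hQ p q g1 g2 (Nat.not_even_iff_odd.mp gp) g3 g4 g5 g6
      (Nat.not_even_iff_odd.mp gq) g7 g8)

/-- PARTNER LAW, first line `i` odd, three right-moving steps (lower outer lines; admissible partners are the
EVEN inner lines with `s (i+d+1) < s p < s i`, `s (i+d+3) < s q < s (i+2)`; forbidden clause `s p < s q`). -/
theorem partner_law_odd (s b : ℕ → ℝ) (i d : ℕ) (hi : Odd i) (hd : Odd d)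
    (hA0 : ∃ θ : ℝ, ∀ e o : ℕ, i ≤ e → e ≤ i + d → i ≤ o → o ≤ i + d → Even e → Odd o →
      b o + s o * θ < b e + s e * θ)
    (hB0 : ∃ θ : ℝ, ∀ e o : ℕ, i + 1 ≤ e → e ≤ i + d + 1 → i + 1 ≤ o → o ≤ i + d + 1 → Even e → Odd o →
      b o + s o * θ < b e + s e * θ)
    (hord0 : ∀ θ θ' : ℝ, (∀ e o : ℕ, i ≤ e → e ≤ i + d → i ≤ o → o ≤ i + d → Even e → Odd o →
      b o + s o * θ < b e + s e * θ) → (∀ e o : ℕ, i + 1 ≤ e → e ≤ i + d + 1 → i + 1 ≤ o → o ≤ i + d + 1 →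
      Even e → Odd o → b o + s o * θ' < b e + s e * θ') → θ < θ')
    (hord1 : ∀ θ θ' : ℝ, (∀ e o : ℕ, i + 1 ≤ e → e ≤ i + d + 1 → i + 1 ≤ o → o ≤ i + d + 1 → Even e →
      Odd o → b o + s o * θ < b e + s e * θ) → (∀ e o : ℕ, i + 2 ≤ e → e ≤ i + d + 2 → i + 2 ≤ o →
      o ≤ i + d + 2 → Even e → Odd o → b o + s o * θ' < b e + s e * θ') → θ < θ')
    (hA2 : ∃ θ : ℝ, ∀ e o : ℕ, i + 2 ≤ e → e ≤ i + d + 2 → i + 2 ≤ o → o ≤ i + d + 2 → Even e → Odd o →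
      b o + s o * θ < b e + s e * θ)
    (hB2 : ∃ θ : ℝ, ∀ e o : ℕ, i + 3 ≤ e → e ≤ i + d + 3 → i + 3 ≤ o → o ≤ i + d + 3 → Even e → Odd o →
      b o + s o * θ < b e + s e * θ)
    (hord2 : ∀ θ θ' : ℝ, (∀ e o : ℕ, i + 2 ≤ e → e ≤ i + d + 2 → i + 2 ≤ o → o ≤ i + d + 2 → Even e →
      Odd o → b o + s o * θ < b e + s e * θ) → (∀ e o : ℕ, i + 3 ≤ e → e ≤ i + d + 3 → i + 3 ≤ o →
      o ≤ i + d + 3 → Even e → Odd o → b o + s o * θ' < b e + s e * θ') → θ < θ')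
    (hQ : ∀ p q : ℕ, i + 1 ≤ p → p ≤ i + d → Even p → s (i + d + 1) < s p → s p < s i →
      i + 3 ≤ q → q ≤ i + d + 2 → Even q → s (i + d + 3) < s q → s q < s (i + 2) →
      i + 2 ≤ p ∧ q ≤ i + d ∧ s p < s q) :
    False := by
  have hd1 : 1 ≤ d := by
    obtain ⟨l, hl⟩ := hd
    omega
  have hi1 : ¬ Odd (i + 1) := by
    obtain ⟨k, hk⟩ := hi
    exact Nat.not_odd_iff_even.mpr ⟨k + 1, by omega⟩
  have hi3 : ¬ Odd (i + 3) := by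
    obtain ⟨k, hk⟩ := hi
    exact Nat.not_odd_iff_even.mpr ⟨k + 2, by omega⟩
  have hup1 : Odd (i + d + 1) := by
    obtain ⟨k, hk⟩ := hi
    obtain ⟨l, hl⟩ := hd
    exact ⟨k + l + 1, by omega⟩
  have hup2 : Odd (i + 2) := by
    obtain ⟨k, hk⟩ := hi
    exact ⟨k + 1, by omega⟩
  have hup3 : Odd (i + d + 3) := by
    obtain ⟨k, hk⟩ := hi
    obtain ⟨l, hl⟩ := hd
    exact ⟨k + l + 2, by omega⟩
  obtain ⟨θA, hθA⟩ := hA0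
  obtain ⟨θB, hθB⟩ := hB0
  obtain ⟨θC, hθC⟩ := hA2
  obtain ⟨θD, hθD⟩ := hB2
  -- negate all lines: the odd lines become the upper class
  exact partner_law_core (fun n => Odd n) (fun t => -s t) (fun t => -b t) i d hi hup1 hup2 hup3
    ⟨i + 1, le_rfl, by omega, hi1⟩ ⟨i + 3, le_rfl, by omega, hi3⟩
    ⟨θA, sep_neg s b i (i + d) θA hθA⟩
    ⟨θB, sep_neg s b (i + 1) (i + d + 1) θB hθB⟩
    (fun θ θ' hθ hθ' => hord0 θ θ' (sep_of_neg s b i (i + d) θ hθ) (sep_of_neg s b (i + 1) (i + d + 1) θ' hθ'))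
    (fun θ θ' hθ hθ' => hord1 θ θ' (sep_of_neg s b (i + 1) (i + d + 1) θ hθ)
      (sep_of_neg s b (i + 2) (i + d + 2) θ' hθ'))
    ⟨θC, sep_neg s b (i + 2) (i + d + 2) θC hθC⟩
    ⟨θD, sep_neg s b (i + 3) (i + d + 3) θD hθD⟩
    (fun θ θ' hθ hθ' => hord2 θ θ' (sep_of_neg s b (i + 2) (i + d + 2) θ hθ)
      (sep_of_neg s b (i + 3) (i + d + 3) θ' hθ'))
    (fun p q g1 g2 gp g3 g4 g5 g6 gq g7 g8 => by
      obtain ⟨a1, a2, a3⟩ := hQ p q g1 g2 (Nat.not_odd_iff_even.mp gp) (by simpa using g4) (by simpa using g3)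
        g5 g6 (Nat.not_odd_iff_even.mp gq) (by simpa using g8) (by simpa using g7)
      exact ⟨a1, a2, by simpa using a3⟩)

end Summit.ValiantsHypothesis.ValiantsHypothesis.Theorems.KPlusLogSqLawStepPartner
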